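import Summits.CriticalPhenomena.CardyFormulaZ2.Theorems.CardyIKTransportIKLinearTransportQuenchedAssemblyDefs
import Summits.CriticalPhenomena.CardyFormulaZ2.Theorems.CardyIKTransportIKLinearTransportFarRSWOfInputs
import Summits.CriticalPhenomena.CardyFormulaZ2.Theorems.CardyIKTransportIKMixedBoxCrossingQuenchedHarris7

/-!
# Fragment `isoTJunctionFamily_of_approxHarris` (line `pinned-diagram-exchange`, crux
# `CardyIKTransport.IKLinearTransport`, stmt-CriticalPhenomena-5076): the strategist's core target `J_T^∀`
# (the all-aspect T-JUNCTION family of the pure isotropic model) from the shared core `ApproxHarrisFam`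

Support file (`--supports stmt-CriticalPhenomena-5076`, registered stub `isoTJunctionFamily_of_approxHarris`).
The crux-strategist (census s2, `Cruxes/IKLinearTransport/CoreTargets_s2.lean`, def `IsoTJunctionFamily`) typed
the FKG-free core of both RSW residues of the line as the T-junction family for the PURE isotropic
Izergin–Korepin cell model `S = univ`: for every aspect bound `k` a constant `c_k > 0` such that every `w × h`
box with `n ≤ w, h ≤ k n` is crossed left–right AND every box on a column sub-range `[a', a'+w') ⊆ [a, a+w)` of
width `≥ n` sticking out by `m` rows (`1 ≤ m ≤ k n`) below and above it is crossed bottom–top, simultaneously,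
with `ν_univ`-probability `≥ c_k`.  This file proves `ApproxHarrisFam → IsoTJunctionFamily` (conclusion written
inline, verbatim): the T-junction family lies INSIDE the shared quenched core of skeleton v29/v30.

Proof, for a fixed aspect bound `k`.
* BOTH BOXES ARE CROSSED (landed `FarRSWAllAspects.pureIK_boxCrossing_allAspects (3k)`, the isotropic model has
  the box-crossing property at every aspect ratio): the `w × h` box has `w ≤ k n ≤ k h`, `h ≤ k n ≤ k w`; the
  `w' × (h + 2m)` box has `w' ≤ w ≤ k n ≤ k (h + 2m)` and `h + 2m ≤ 3 k n ≤ 3k w'`.  So both annealed crossing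
  probabilities are `≥ c₁ = c₁(3k) > 0`.
* LARGE SCALES `n ≥ n₀`, `n₀ = n₀(2, c₁²/2)` the scale of `ApproxHarrisFam` for two events: the family
  `![⟨true, a, b, w, h⟩, ⟨false, a', b - m, w', h + 2m⟩]` has both boxes at least `n × n`, so
  `μ(LR ∩ TB) ≥ pLR · pTB − c₁²/2 ≥ c₁²/2`; and `μIK (obs ⁻¹' E) ≤ ν(E)` for every set `E` (`νmix = map obs`,
  `Measure.le_map_apply`).
* SMALL SCALES `1 ≤ n < n₀` (`tJunction_small`): all sizes are bounded (`w ≤ k n₀`, `h + 2m ≤ 3 k n₀`), and the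
  ALL-BLACK bounding box `[a, a+w) × [b-m, b+h+m)` (at most `3 k² n₀²` cells) realises both crossings
  (`frsw_mem_lrCross_of_allBlack` along the bottom row of the `w × h` box, `frsw_mem_tbCross_of_allBlack` up the
  left column of the tall box — horizontal and vertical neighbours are edges of the triangulation whatever the
  diagonals); forcing its cells black costs a bounded factor by the landed single-cell finite energy
  (`crsw_condBound_of_cellFlips` with the explicit flips `exists_cellFlip rowFlip_spec colFlip_spec faceFlip_spec`,
  read at the trivial conditioning `E = univ`), for EVERY column pattern `S`.
So `c_k = min (c₁²/2) c_fe` works.  Theorems only (no new vocabulary); no positive association is used.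
-/

noncomputable section

namespace Summit.CriticalPhenomena.CardyFormulaZ2.Theorems.IKLinearTransport.PinnedDiagramExchange.QuenchedAssembly

open scoped Classical BigOperators ENNReal symmDiff
open MeasureTheory Set
open Summit.CriticalPhenomena.CardyFormulaZ2.Theorems.IKLinearTransport.PinnedDiagramExchange
open Summit.CriticalPhenomena.CardyFormulaZ2.Cruxes.IKMixedBoxCrossing.QuenchedChainFKG
  (ApproxHarrisFam BoxSpec boxEvent boxProb boxProb_lr boxProb_tb)
open Summit.CriticalPhenomena.CardyFormulaZ2.Cruxes.IKMixedBoxCrossing.QuenchedChainFKG.Harris7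
  (boxEvent_lr boxEvent_tb)
open Summit.CriticalPhenomena.CardyFormulaZ2.Cruxes.IKMixedBoxCrossing.PairedMirrorExploration (pLR pTB)
open Summit.CriticalPhenomena.CardyFormulaZ2.Theorems.IKLinearTransport.PinnedDiagramExchange.FarRSWAllAspects
  (pureIK_boxCrossing_allAspects)
open Literature.Probability.Percolation Literature.Probability.LatticeModels

namespace IsoTJunction

/-! ## §1 Small scales: the all-black bounding box, by single-cell finite energy -/

/-- SMALL SCALES OF THE T-JUNCTION, EVERY PATTERN: for every aspect bound `k` and threshold `M` one constant
`c > 0` bounds from below, for all scales `1 ≤ n < M`, all patterns `S` and all admissible positions and sizes,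
the `ν_S`-probability that the `w × h` box at `(a, b)` is crossed left–right AND the `w' × (h + 2m)` box at
`(a', b - m)` (`[a', a'+w') ⊆ [a, a+w)`) is crossed bottom–top — force the bounding box `[a, a+w) × [b-m, b+h+m)`
(at most `k M · 3 k M` cells) to be black (`crsw_condBound_of_cellFlips` at the trivial conditioning, explicit
flips `exists_cellFlip`); an all-black box is crossed both ways whatever the diagonals. [folklore] -/
theorem tJunction_small (k M : ℕ) : ∃ c : ℝ, 0 < c ∧ ∀ (S : Set ℤ) (n : ℕ), 1 ≤ n → n < M →
    ∀ (a b : ℤ) (w h : ℕ), n ≤ w → w ≤ k * n → n ≤ h → h ≤ k * n → ∀ (a' : ℤ) (w' m : ℕ), a ≤ a' →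
      a' + w' ≤ a + w → n ≤ w' → 1 ≤ m → m ≤ k * n →
        c ≤ (νmix S).real (lrCross a b w h ∩ tbCross a' (b - m) w' (h + 2 * m)) := by
  have hcell := fun c => exists_cellFlip (R := fun T ω => ((ω.1 ∆ T, ω.2) : Ω))
    (C := fun T ω => ((ω.1, ω.2.1 ∆ T, ω.2.2) : Ω))
    (F := fun g ω => ((ω.1, ω.2.1, ω.2.2.1 ∆ {g}, ω.2.2.2.1 ∆ {g}, ω.2.2.2.2) : Ω))
    rowFlip_spec colFlip_spec faceFlip_spec c
  have hKtop := ENNReal.pow_ne_top (n := 4) faceFlip_factor_ne_top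
  obtain ⟨-, -, hpos⟩ := crsw_factor_props hcell hKtop (k * M * (3 * (k * M)))
  refine ⟨_, inv_pos.2 hpos, fun S n hn hnM a b w h hnw hwk hnh hhk a' w' m haa' haw' hnw' _ hmk => ?_⟩
  haveI : IsProbabilityMeasure (νmix S) := isProbabilityMeasure_nuMix S
  have hw1 : 1 ≤ w := hn.trans hnw
  have hh1 : 1 ≤ h := hn.trans hnh
  have hw'1 : 1 ≤ w' := hn.trans hnw'
  have hkM : k * n ≤ k * M := Nat.mul_le_mul_left k hnM.le
  have key := crsw_condBound_of_cellFlips hcell hKtop S (Λ := (∅ : Set (Site 2))) (E := Set.univ)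
    (C := lrCross a b w h ∩ tbCross a' (b - m) w' (h + 2 * m)) MeasurableSet.univ
    (fun _ _ _ => iff_of_true (Set.mem_univ _) (Set.mem_univ _))
    (((Finset.Ico a (a + w)) ×ˢ (Finset.Ico (b - m) (b - m + (h + 2 * m : ℕ)))).image
      (fun p : ℤ × ℤ => (![p.1, p.2] : Site 2)))
    (fun c _ hc => hc) (fun x hx => ⟨?_, ?_⟩) (N := k * M * (3 * (k * M)))
    ((crsw_card_boxCells_le _ _ _ _).trans (Nat.mul_le_mul (hwk.trans hkM) (by omega)))
  · rwa [probReal_univ, mul_one, Set.univ_inter] at key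
  · -- the `w × h` box is black, hence crossed left–right along its bottom row
    exact frsw_mem_lrCross_of_allBlack a b hw1 hh1 x fun v h1 h2 h3 h4 =>
      hx v ((crsw_mem_boxCells_iff _ _ _ _ v).2 ⟨h1, h2, by omega, by push_cast; omega⟩)
  · -- the tall box is black, hence crossed bottom–top up its left column
    exact frsw_mem_tbCross_of_allBlack a' (b - m) hw'1 (by omega) x fun v h1 h2 h3 h4 =>
      hx v ((crsw_mem_boxCells_iff _ _ _ _ v).2 ⟨by omega, by omega, h3, h4⟩)

/-! ## §2 Large scales: the two boxes as one family -/

/-- SIZES OF THE T-JUNCTION FAMILY: both boxes of `![⟨true, a, b, w, h⟩, ⟨false, a', b - m, w', h + 2m⟩]` are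
at least `n × n` when `n ≤ w`, `n ≤ h`, `n ≤ w'`. [folklore] -/
theorem tJunction_family_sizes (a b : ℤ) (w h n : ℕ) (a' : ℤ) (w' m : ℕ) (hnw : n ≤ w) (hnh : n ≤ h)
    (hnw' : n ≤ w') :
    ∀ i, n ≤ ((![⟨true, a, b, w, h⟩, ⟨false, a', b - m, w', h + 2 * m⟩] : Fin 2 → BoxSpec) i).w ∧
      n ≤ ((![⟨true, a, b, w, h⟩, ⟨false, a', b - m, w', h + 2 * m⟩] : Fin 2 → BoxSpec) i).h := by
  simp only [Fin.forall_fin_succ, IsEmpty.forall_iff, and_true, Matrix.cons_val_zero, Matrix.cons_val_succ]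
  exact ⟨⟨hnw, hnh⟩, hnw', by omega⟩

/-- THE T-JUNCTION FAMILY REALISES THE T-JUNCTION: the intersection of its two box events is the gauge event
of `lrCross a b w h ∩ tbCross a' (b - m) w' (h + 2m)`. [folklore] -/
theorem iInter_tJunction_subset (S : Set ℤ) (a b : ℤ) (w h : ℕ) (a' : ℤ) (w' m : ℕ) :
    (⋂ i, boxEvent S ((![⟨true, a, b, w, h⟩, ⟨false, a', b - m, w', h + 2 * m⟩] : Fin 2 → BoxSpec) i)) ⊆
      obs S ⁻¹' (lrCross a b w h ∩ tbCross a' (b - m) w' (h + 2 * m)) := by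
  intro ω hω
  have h' := Set.mem_iInter.1 hω
  simp only [Fin.forall_fin_succ, IsEmpty.forall_iff, and_true, Matrix.cons_val_zero, Matrix.cons_val_succ,
    boxEvent_lr, boxEvent_tb, Set.mem_preimage] at h'
  exact ⟨h'.1, h'.2⟩

/-- THE PRODUCT OF THE T-JUNCTION FAMILY is `pLR · pTB`. [folklore] -/
theorem prod_tJunction (S : Set ℤ) (a b : ℤ) (w h : ℕ) (a' : ℤ) (w' m : ℕ) :
    ∏ i, boxProb S ((![⟨true, a, b, w, h⟩, ⟨false, a', b - m, w', h + 2 * m⟩] : Fin 2 → BoxSpec) i) =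
      pLR S a b w h * pTB S a' (b - m) w' (h + 2 * m) := by
  rw [Fin.prod_univ_two]
  rfl

/-- TRANSFER WITHOUT MEASURABILITY, at the isotropic pattern: `μIK (obs univ ⁻¹' E) ≤ ν_univ(E)` for every set
`E` of observables (`νmix = μIK.map obs`, `Measure.le_map_apply`). [folklore] -/
theorem real_preimage_le_nuMix_univ (E : Set Obs) :
    μIK.real (obs Set.univ ⁻¹' E) ≤ (νmix Set.univ).real E := by
  haveI : IsProbabilityMeasure (νmix Set.univ) := isProbabilityMeasure_nuMix Set.univ
  rw [measureReal_def, measureReal_def]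
  exact ENNReal.toReal_mono (measure_ne_top _ _)
    (Measure.le_map_apply (CouplingToLimits.measurable_obs Set.univ).aemeasurable E)

end IsoTJunction

open IsoTJunction in
/-- **THE T-JUNCTION FAMILY OF THE PURE ISOTROPIC MODEL FROM THE SHARED CORE** (registered stub
`isoTJunctionFamily_of_approxHarris`; conclusion = the strategist's `IsoTJunctionFamily`, census s2): under
`ApproxHarrisFam`, for every aspect bound `k` there is `c > 0` such that for every `n ≥ 1`, every `w × h` box at
`(a, b)` with `n ≤ w ≤ k n`, `n ≤ h ≤ k n`, every column sub-range `[a', a'+w') ⊆ [a, a+w)` of width `≥ n` and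
every slack `1 ≤ m ≤ k n`, the box is crossed left–right AND the `w' × (h + 2m)` box at `(a', b - m)` is crossed
bottom–top, with `ν_univ`-probability `≥ c` — both crossing probabilities are `≥ c₁(3k)`
(`pureIK_boxCrossing_allAspects`), approximate Harris for the two-membered family beyond its scale `n₀`, and the
all-black bounding box (`tJunction_small`) below it. -/
theorem isoTJunctionFamily_of_approxHarris : ApproxHarrisFam → ∀ k : ℕ, ∃ c : ℝ, 0 < c ∧ ∀ n : ℕ, 1 ≤ n → ∀ (a b : ℤ) (w h : ℕ), n ≤ w → w ≤ k * n → n ≤ h → h ≤ k * n → ∀ (a' : ℤ) (w' m : ℕ), a ≤ a' → a' + w' ≤ a + w → n ≤ w' → 1 ≤ m → m ≤ k * n → c ≤ (νmix Set.univ).real (lrCross a b w h ∩ tbCross a' (b - m) w' (h + 2 * m)) := by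
  intro hFam k
  obtain ⟨c₁, hc₁, hbox⟩ := pureIK_boxCrossing_allAspects (3 * k)
  obtain ⟨n₀, hn₀⟩ := hFam 2 (c₁ * c₁ / 2) (by positivity)
  obtain ⟨c₂, hc₂, hsmall⟩ := tJunction_small k n₀
  refine ⟨min (c₁ * c₁ / 2) c₂, lt_min (by positivity) hc₂, ?_⟩
  intro n hn a b w h hnw hwk hnh hhk a' w' m haa' haw' hnw' hm hmk
  rcases Nat.lt_or_ge n n₀ with hlt | hge
  · -- scales `n < n₀`: the all-black bounding box
    exact (min_le_right _ _).trans (hsmall Set.univ n hn hlt a b w h hnw hwk hnh hhk a' w' m haa' haw' hnw' hm hmk)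
  · -- scales `n ≥ n₀`: both boxes are crossed, and ONE application of approximate Harris
    haveI := CouplingToLimits.isProbabilityMeasure_μIK
    have hw'w : w' ≤ w := by omega
    have h3k : 3 * k * n = k * n + 2 * (k * n) := by ring
    have hkh : k * n ≤ k * h := Nat.mul_le_mul_left k hnh
    have hkw : k * n ≤ k * w := Nat.mul_le_mul_left k hnw
    have hkw' : k * n ≤ k * w' := Nat.mul_le_mul_left k hnw'
    have hk3 : ∀ s : ℕ, k * s ≤ 3 * k * s := fun s => by nlinarith
    have hkhm : k * h ≤ k * (h + 2 * m) := Nat.mul_le_mul_left k (Nat.le_add_right h _)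
    have hLR : c₁ ≤ pLR Set.univ a b w h :=
      (hbox a b w h (by omega) (by omega) (by nlinarith [hk3 h]) (by nlinarith [hk3 w])).1
    have hTB : c₁ ≤ pTB Set.univ a' (b - m) w' (h + 2 * m) :=
      (hbox a' (b - m) w' (h + 2 * m) (by omega) (by omega) (by nlinarith [hk3 (h + 2 * m)])
        (by nlinarith [hk3 w'])).2
    have hHarris := hn₀ Set.univ n hge _ (tJunction_family_sizes a b w h n a' w' m hnw hnh hnw')
    rw [prod_tJunction] at hHarris
    have htrans : μIK.real (⋂ i, boxEvent Set.univ
        ((![⟨true, a, b, w, h⟩, ⟨false, a', b - m, w', h + 2 * m⟩] : Fin 2 → BoxSpec) i)) ≤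
        (νmix Set.univ).real (lrCross a b w h ∩ tbCross a' (b - m) w' (h + 2 * m)) :=
      (measureReal_mono (iInter_tJunction_subset Set.univ a b w h a' w' m)).trans
        (real_preimage_le_nuMix_univ _)
    have hprod : c₁ * c₁ ≤ pLR Set.univ a b w h * pTB Set.univ a' (b - m) w' (h + 2 * m) :=
      mul_le_mul hLR hTB hc₁.le (hc₁.le.trans hLR)
    calc min (c₁ * c₁ / 2) c₂ ≤ c₁ * c₁ / 2 := min_le_left _ _
      _ ≤ (νmix Set.univ).real (lrCross a b w h ∩ tbCross a' (b - m) w' (h + 2 * m)) := by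
          linarith [hHarris.trans htrans]

end Summit.CriticalPhenomena.CardyFormulaZ2.Theorems.IKLinearTransport.PinnedDiagramExchange.QuenchedAssembly

end
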